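import Mathlib
import Summits.ResolutionOfSingularities.ResolutionOfSingularities.Theorems.RadicialJungCleanModelsCleanProp44VertexInsertionUnit
import HarnessLib

/-!
# Route `RadicialJung`, crux `CleanModels` (stmt-ResolutionOfSingularities-15917), line `Sketch` rev 35, stub 6 `stub_cleanProp44` (X44c):
# INSERTION AT A BIRTH / CROSS POINT — the strict transform is clean-permissible unless the SAME unit is a birth again

Seat decomp-res-hand-2 g19 (structural hand); sequel of ✓ `…CleanProp44VertexInsertion{,Unit}.lean`.  The OTHER obstruction of
✓ `cleanPermissibleAt_nearLine_or_vertex_or_cross` (hand-2 g18): at a point `x` of a regular curve germ `N = (e, y)` (`(e, y, z) = 𝔪_x`) where no charged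
side passes and the transform is `U · e^A` with `p ∣ A` and `U` a unit FAILING the non-birth test (a birth, located by the cross hypersurfaces), `N` is not
clean-permissible.  INSERT: blow up `x` (`σ : X' → X`, `J_x = 𝔪_x`) and let `x' ∈ σ⁻¹(x)` lie on the strict transforms of `V(e)` and `V(y)`:
`σ^♯ e = E · ε`, `σ^♯ y = E · ζ`, `ε, ζ ∈ 𝔪_{x'}`.  The vertex-insertion theorem applies VERBATIM in the regular system `(z, y + z, e)` (exponents
`(0, 0, A)`; `N` is transversal to `V(z)` and to `V(y + z)`), and its explicit unit is `σ^♯ U` itself: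

* `cleanPermissibleAt_strictTransform_of_unitForm_or_birth` — `(E, ε, ζ) = 𝔪_{x'}`; the transform is `σ^♯ U · ε^A · E^A`; and the strict transform
  `N' = (ε, ζ)` is CLEAN-PERMISSIBLE at `x'` unless `p ∣ A` and `σ^♯ U` — the SAME unit, read at `x'` — fails the non-birth test for `N'`.  So along a
  chain of insertions at births the only datum that moves is the position of the pulled-back unit against `(N^{(j)} + 𝔪²)`, i.e. the `δ*`/`ν`
  invariant of memo `Sketch-memo-4e-cleanPermissible.md` §2.5–2.6 — the termination question (iii) of memo g18 §2 (d) is isolated as a statement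
  about ONE unit along the chain.
* plumbing: `span_triple_shear_eq` (`(z, y + z, e) = (e, y, z)`).

Honest framing: OURS, bookkeeping; the descent itself is NOT here.  Nothing here proves X44c, any case of `CleanModels`, or resolution of singularities in
characteristic `p`.  Setting only: [cite: CossartPiltant2008, Lemma 4.3 (5); Prop. 4.4 (proof, p. 11)] [cite: Piltant2013, §2 Axiom 4].
-/

noncomputable section

set_option linter.dupNamespace false -- mandated namespace of this single-conjunct summit

open IsLocalRing CategoryTheory AlgebraicGeometry
open Literature.AlgebraicGeometry.Resolution Literature.AlgebraicGeometry.Motives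

namespace Summit.ResolutionOfSingularities.ResolutionOfSingularities.Theorems.RadicialJung.CleanModels

universe u

/-- The shear `(z, y + z, e)` generates the same ideal as `(e, y, z)`. [folklore] -/
theorem span_triple_shear_eq {R : Type u} [CommRing R] (e y z : R) :
    Ideal.span ({z, y + z, e} : Set R) = Ideal.span ({e, y, z} : Set R) := by
  apply le_antisymm
  · rw [Ideal.span_le, Set.insert_subset_iff, Set.insert_subset_iff, Set.singleton_subset_iff]
    exact ⟨Ideal.subset_span (by simp), Ideal.add_mem _ (Ideal.subset_span (by simp)) (Ideal.subset_span (by simp)),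
      Ideal.subset_span (by simp)⟩
  · rw [Ideal.span_le, Set.insert_subset_iff, Set.insert_subset_iff, Set.singleton_subset_iff]
    refine ⟨Ideal.subset_span (by simp), ?_, Ideal.subset_span (by simp)⟩
    have h : y = (y + z) - z := by ring
    rw [SetLike.mem_coe, h]
    exact Ideal.sub_mem _ (Ideal.subset_span (by simp)) (Ideal.subset_span (by simp))

section Scheme

variable {p : ℕ} {X X' : Scheme.{u}} [IsIntegral X] [IsIntegral X'] {σ : X' ⟶ X} [IsDominant σ] {J : X.IdealSheafData}

set_option maxHeartbeats 1600000 in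
-- the vertex-insertion theorem in sheared coordinates
/-- **INSERTION AT A BIRTH: the strict transform is clean-permissible unless the same unit is a birth again.**  See the module docstring.
[cite: CossartPiltant2008, Lemma 4.3 (5); Prop. 4.4 (proof, p. 11)] [cite: Piltant2013, §2 Axiom 4] -/
theorem cleanPermissibleAt_strictTransform_of_unitForm_or_birth [Fact p.Prime] [CharP X'.functionField p] (hσ : IsBlowup σ J) (x' : X')
    (hR : IsRegularLocalRing (X.presheaf.stalk (σ x'))) (hdim : ringKrullDim (X.presheaf.stalk (σ x')) = (3 : ℕ))
    (hJ : stalkIdeal J (σ x') = maximalIdeal (X.presheaf.stalk (σ x'))) {e y z : X.presheaf.stalk (σ x')}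
    (hzz : Ideal.span ({e, y, z} : Set (X.presheaf.stalk (σ x'))) = maximalIdeal (X.presheaf.stalk (σ x')))
    {G : X.functionField} {cc : Fin p → X.functionField} (hcc : ∃ j : Fin p, (j : ℕ) ≠ 0 ∧ cc j ≠ 0)
    {U : X.presheaf.stalk (σ x')} (hU : IsUnit U) (A : ℕ)
    (hrep : (∑ j : Fin p, cc j ^ p * G ^ (j : ℕ)) = RatFn.toFunctionField (σ x') (U * e ^ A))
    (hdim' : ringKrullDim (X'.presheaf.stalk x') = 3) {E ε ζ : X'.presheaf.stalk x'}
    (hE : Ideal.span {E} = (maximalIdeal (X.presheaf.stalk (σ x'))).map (σ.stalkMap x').hom)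
    (hε : (σ.stalkMap x').hom e = E * ε) (hεm : ε ∈ maximalIdeal (X'.presheaf.stalk x'))
    (hζ : (σ.stalkMap x').hom y = E * ζ) (hζm : ζ ∈ maximalIdeal (X'.presheaf.stalk x')) :
    Ideal.span ({E, ε, ζ} : Set (X'.presheaf.stalk x')) = maximalIdeal (X'.presheaf.stalk x') ∧
    (∑ j : Fin p, RatFn.functionFieldMap σ (cc j) ^ p * RatFn.functionFieldMap σ G ^ (j : ℕ)) =
      RatFn.toFunctionField x' ((σ.stalkMap x').hom U * ε ^ A * E ^ A) ∧
    (CleanPermissibleAt p (RatFn.toFunctionField x') (RatFn.functionFieldMap σ G) (Ideal.span ({ε, ζ} : Set (X'.presheaf.stalk x'))) ∨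
      (p ∣ A ∧
        ¬ ((∀ c' : X'.presheaf.stalk x', (σ.stalkMap x').hom U - c' ^ p ∉ maximalIdeal (X'.presheaf.stalk x')) ∨
          (∃ c' : X'.presheaf.stalk x', (σ.stalkMap x').hom U - c' ^ p ∈ maximalIdeal (X'.presheaf.stalk x') ∧
            (σ.stalkMap x').hom U - c' ^ p ∉ Ideal.span ({ε, ζ} : Set (X'.presheaf.stalk x')) ⊔ maximalIdeal (X'.presheaf.stalk x') ^ 2) ∨
          (∃ c' : X'.presheaf.stalk x', (σ.stalkMap x').hom U - c' ^ p ∈ Ideal.span ({ε, ζ} : Set (X'.presheaf.stalk x')) ∧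
            (σ.stalkMap x').hom U - c' ^ p ∉ maximalIdeal (X'.presheaf.stalk x') ^ 2)))) := by
  classical
  -- the sheared regular system `c = (z, y + z, e)` with exponents `(0, 0, A)`
  have hc : Ideal.span (Set.range (![z, y + z, e] : Fin 3 → X.presheaf.stalk (σ x'))) = maximalIdeal (X.presheaf.stalk (σ x')) := by
    rw [← hzz, ← span_triple_shear_eq e y z]
    congr 1
    ext t
    simp only [Set.mem_range, Set.mem_insert_iff, Set.mem_singleton_iff]
    constructor
    · rintro ⟨j, rfl⟩
      fin_cases j <;> simp
    · rintro (rfl | rfl | rfl)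
      exacts [⟨0, rfl⟩, ⟨1, rfl⟩, ⟨2, rfl⟩]
  have hrep' : (∑ j : Fin p, cc j ^ p * G ^ (j : ℕ)) = RatFn.toFunctionField (σ x')
      (U * ∏ k, (![z, y + z, e] : Fin 3 → X.presheaf.stalk (σ x')) k ^ (![0, 0, A] : Fin 3 → ℕ) k) := by
    rw [hrep, Fin.prod_univ_three]
    simp only [Matrix.cons_val_zero, Matrix.cons_val_one, Matrix.cons_val_two, Matrix.head_cons, Matrix.tail_cons, pow_zero, one_mul]
  have hswap : ∀ a₁ a₂ a₃ : X.presheaf.stalk (σ x'), Ideal.span ({a₂, a₃, a₁} : Set (X.presheaf.stalk (σ x'))) = Ideal.span {a₁, a₂, a₃} := by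
    intro a₁ a₂ a₃
    congr 1
    ext r
    simp only [Set.mem_insert_iff, Set.mem_singleton_iff]
    tauto
  have hz' : ∀ k : Fin 3, k ≠ 2 → Ideal.span ({y, (![z, y + z, e] : Fin 3 → X.presheaf.stalk (σ x')) k,
      (![z, y + z, e] : Fin 3 → X.presheaf.stalk (σ x')) 2} : Set (X.presheaf.stalk (σ x'))) = maximalIdeal (X.presheaf.stalk (σ x')) := by
    intro k hk
    fin_cases k
    · change Ideal.span ({y, z, e} : Set (X.presheaf.stalk (σ x'))) = _
      rw [hswap]; exact hzz
    · change Ideal.span ({y, y + z, e} : Set (X.presheaf.stalk (σ x'))) = _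
      rw [hswap, ← hzz]
      apply le_antisymm
      · rw [Ideal.span_le, Set.insert_subset_iff, Set.insert_subset_iff, Set.singleton_subset_iff]
        exact ⟨Ideal.subset_span (by simp), Ideal.subset_span (by simp),
          Ideal.add_mem _ (Ideal.subset_span (by simp)) (Ideal.subset_span (by simp))⟩
      · rw [Ideal.span_le, Set.insert_subset_iff, Set.insert_subset_iff, Set.singleton_subset_iff]
        refine ⟨Ideal.subset_span (by simp), Ideal.subset_span (by simp), ?_⟩
        have h : z = (y + z) - y := by ring
        rw [SetLike.mem_coe, h]
        exact Ideal.sub_mem _ (Ideal.subset_span (by simp)) (Ideal.subset_span (by simp))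
    · exact absurd rfl hk
  have hε2 : (σ.stalkMap x').hom ((![z, y + z, e] : Fin 3 → X.presheaf.stalk (σ x')) 2) = E * ε := hε
  -- the insertion theorem, then the units `ρ`, then the explicit form
  obtain ⟨htriple, hpass, -⟩ :=
    cleanPermissibleAt_strictTransform_of_vertex_or_birth hσ x' hR _ hc hdim hJ hcc hU _ hrep' 2 hz' hdim' hE hε2 hεm hζ hζm
  obtain ⟨ρ, hρ⟩ := exists_units_of_vertexInsertion x' _ 2 hE hpass
  obtain ⟨-, hrepU, hdisj⟩ :=
    cleanPermissibleAt_strictTransform_of_vertex_or_birth_explicit hσ x' hR _ hc hdim hJ hcc hU _ hrep' 2 hz' hdim' hE hε2 hεm hζ hζm hρ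
  -- the explicit unit is `σ^♯ U`
  have hone : ∏ k ∈ Finset.univ.erase (2 : Fin 3), ρ k ^ (![0, 0, A] : Fin 3 → ℕ) k = 1 := by
    refine Finset.prod_eq_one fun k hk => ?_
    have hk2 : k ≠ 2 := Finset.ne_of_mem_erase hk
    fin_cases k
    · simp
    · simp
    · exact absurd rfl hk2
  have hsum : ∑ k, (![0, 0, A] : Fin 3 → ℕ) k = A := by
    rw [Fin.sum_univ_three]
    simp
  have hA2 : (![0, 0, A] : Fin 3 → ℕ) 2 = A := rfl
  rw [hone, mul_one, hsum, hA2] at hrepU hdisj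
  refine ⟨htriple, hrepU, ?_⟩
  rcases hdisj with h | ⟨h₁, -, h₃⟩
  · exact Or.inl h
  · exact Or.inr ⟨h₁, h₃⟩

end Scheme

end Summit.ResolutionOfSingularities.ResolutionOfSingularities.Theorems.RadicialJung.CleanModels

end
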